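import Summits.CriticalPhenomena.PercolationContinuityZ3.Theorems.PercNearOneGluingNoHeavyLowerTailFloorSplitCIL
import HarnessLib

/-!
# `NoHeavyLowerTail` (stmt-CriticalPhenomena-4575) — the PRE-FKG floor-split CIL (PRE-FSCIL) closes the crux

Typed target of lemma factory #5 (`prim-lf-5`, gen 12; memo `run/shared/lean/prim/prim-lf-5/PRE-FSCIL.md`,
candidate A20).  `--supports stmt-CriticalPhenomena-4575`.  No definitions, no named facts, no sorries.

Notation: `μ = prodBernoulli w` on `Fin n`, relays `A`, observer `o ∉ A`, `N = |{x ∈ A : o ↔ x}|`, `N_a = |{x ∈ A : a ↔ x}|`,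
`u = μ(o ↔ A)`, Kozma–Nitzan's singleton ratios `φ_a = μ(o ↔ a, N_a = 1)/μ(N_a = 1)`, and the JOINT lightness
`S_a = μ(o ↔ A, N_a ≤ j)`.  **PRE-FSCIL** (with the `S`-champion as witness) is the candidate inequality

  `u · μ(1 ≤ N ≤ j) ≤ Σ_{a ∈ A} φ_a · S_a + (u − Σ_{a ∈ A} φ_a) · S_c`   for every `c ∈ A` with `S_a ≤ S_c` (`a ∈ A`),

i.e. `μ(N ≤ j | o ↔ A) ≤ Σ_a λ_a μ(N_a ≤ j | o ↔ A)` for the probability vector `λ = (φ + σ'δ_c)/u` — the pre-FKG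
(Kozma–Nitzan Question-5 shaped) strengthening of FSCIL (`noHeavyLowerTail_of_floorSplitCIL`).  It is PROVED for one-layer
observers at every level (`floorSplitCIL_oneLayer_pre`, H-witness form) and at level `j = 1` for every observer
(`PreFloorSplitLevelOne.preFloorSplit_level_one`).  This file records that it closes the crux: `Σ_a φ_a S_a ≤ (Σ_a φ_a) S_c`
gives `u·μ(1 ≤ N ≤ j) ≤ u·S_c`, hence (for `u > 0`; for `u = 0` the bad event is null) `μ(1 ≤ N ≤ j) ≤ S_c ≤ μ(N_c ≤ j)`, which is
the cumulative isolation lemma with witness `c` (`noHeavyLowerTail_of_stub_cumulativeIsolation`).  No sign information on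
`u − Σφ` (Kozma–Nitzan Lemma 2) is needed.
-/

noncomputable section

namespace Summit.CriticalPhenomena.PercolationContinuityZ3.Theorems

open MeasureTheory Set Literature.Probability.LatticeModels Literature.Probability.Percolation
open scoped Classical BigOperators

/-- **PRE-FSCIL closes the crux.**  If on every finite weighted graph, for every nonempty relay set `A`, observer `o ∉ A`,
level `j` and every `c ∈ A` whose joint lightness `μ(o ↔ A, N_c ≤ j)` dominates all `μ(o ↔ A, N_a ≤ j)`,
`μ(o↔A)·μ(1 ≤ N ≤ j) ≤ Σ_a φ_a μ(o↔A, N_a ≤ j) + (μ(o↔A) − Σ_a φ_a) μ(o↔A, N_c ≤ j)` with `φ_a = μ(o ↔ a, N_a = 1)/μ(N_a = 1)`,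
then `NoHeavyLowerTail` holds. [this work; cite: KozmaNitzan2024, Lemma 2 (p. 6) for `φ`, Question 5 (p. 32)] -/
theorem noHeavyLowerTail_of_preFloorSplitCIL
    (hPre : ∀ (n : ℕ) (w : Sym2 (Fin n) → unitInterval) (A : Finset (Fin n)) (o : Fin n) (j : ℕ),
      A.Nonempty → o ∉ A → ∀ c ∈ A,
        (∀ a ∈ A,
          (prodBernoulli w).real ((⋃ b ∈ A, (openConn o b : Set (BondConfig (Fin n)))) ∩
              {ω | (A.filter fun x => ω ∈ openConn a x).card ≤ j}) ≤
            (prodBernoulli w).real ((⋃ b ∈ A, (openConn o b : Set (BondConfig (Fin n)))) ∩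
              {ω | (A.filter fun x => ω ∈ openConn c x).card ≤ j})) →
        (prodBernoulli w).real (⋃ a ∈ A, (openConn o a : Set (BondConfig (Fin n)))) *
            (prodBernoulli w).real {ω : BondConfig (Fin n) |
              1 ≤ (A.filter fun x => ω ∈ openConn o x).card ∧
                (A.filter fun x => ω ∈ openConn o x).card ≤ j} ≤
          (∑ a ∈ A,
              (prodBernoulli w).real
                  ((openConn o a : Set (BondConfig (Fin n))) ∩
                    {ω | (A.filter fun x => ω ∈ openConn a x).card = 1}) /
                (prodBernoulli w).real {ω : BondConfig (Fin n) |
                  (A.filter fun x => ω ∈ openConn a x).card = 1} *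
              (prodBernoulli w).real ((⋃ b ∈ A, (openConn o b : Set (BondConfig (Fin n)))) ∩
                {ω | (A.filter fun x => ω ∈ openConn a x).card ≤ j})) +
            ((prodBernoulli w).real (⋃ a ∈ A, (openConn o a : Set (BondConfig (Fin n)))) -
                ∑ a ∈ A,
                  (prodBernoulli w).real
                      ((openConn o a : Set (BondConfig (Fin n))) ∩
                        {ω | (A.filter fun x => ω ∈ openConn a x).card = 1}) /
                    (prodBernoulli w).real {ω : BondConfig (Fin n) |
                      (A.filter fun x => ω ∈ openConn a x).card = 1}) *
              (prodBernoulli w).real ((⋃ b ∈ A, (openConn o b : Set (BondConfig (Fin n)))) ∩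
                {ω | (A.filter fun x => ω ∈ openConn c x).card ≤ j})) :
    Summit.CriticalPhenomena.PercolationContinuityZ3.Theses.PercNearOneGluing.NoHeavyLowerTail := by
  refine noHeavyLowerTail_of_stub_cumulativeIsolation fun n w A o j hA ho => ?_
  set μ := prodBernoulli w with hμ
  set X : Set (BondConfig (Fin n)) := ⋃ b ∈ A, (openConn o b : Set (BondConfig (Fin n))) with hX
  set S : Fin n → ℝ := fun a =>
    μ.real (X ∩ {ω | (A.filter fun x => ω ∈ openConn a x).card ≤ j}) with hS
  set φ : Fin n → ℝ := fun a =>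
    μ.real ((openConn o a : Set (BondConfig (Fin n))) ∩
        {ω | (A.filter fun x => ω ∈ openConn a x).card = 1}) /
      μ.real {ω : BondConfig (Fin n) | (A.filter fun x => ω ∈ openConn a x).card = 1} with hφ
  set bad : ℝ := μ.real {ω : BondConfig (Fin n) |
    1 ≤ (A.filter fun x => ω ∈ openConn o x).card ∧ (A.filter fun x => ω ∈ openConn o x).card ≤ j} with hbad
  -- an `S`-champion `c`
  obtain ⟨c, hcA, hcmax⟩ := Finset.exists_max_image A S hA
  refine ⟨c, hcA, ?_⟩
  have hmain := hPre n w A o j hA ho c hcA (fun a ha => hcmax a ha)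
  have hφnn : ∀ a, 0 ≤ φ a := fun a => by
    simp only [hφ]; exact div_nonneg measureReal_nonneg measureReal_nonneg
  have hu0 : 0 ≤ μ.real X := measureReal_nonneg
  -- `Σ_a φ_a S_a ≤ (Σ_a φ_a) S_c`, so the right side is at most `u · S_c`
  have hsum : ∑ a ∈ A, φ a * S a ≤ (∑ a ∈ A, φ a) * S c := by
    rw [Finset.sum_mul]
    exact Finset.sum_le_sum fun a ha => mul_le_mul_of_nonneg_left (hcmax a ha) (hφnn a)
  have hRHS : (∑ a ∈ A, φ a * S a) + (μ.real X - ∑ a ∈ A, φ a) * S c ≤ μ.real X * S c := by nlinarith [hsum]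
  have hub : μ.real X * bad ≤ μ.real X * S c := le_trans hmain hRHS
  -- `S_c ≤ μ(N_c ≤ j)` and `bad ≤ u`
  have hSI : S c ≤ μ.real {ω : BondConfig (Fin n) | (A.filter fun x => ω ∈ openConn c x).card ≤ j} :=
    measureReal_mono Set.inter_subset_right (measure_ne_top μ _)
  have hbadX : bad ≤ μ.real X := by
    refine measureReal_mono (fun ω hω => ?_) (measure_ne_top μ _)
    obtain ⟨h1, -⟩ := hω
    rw [Nat.succ_le_iff, Finset.card_pos, Finset.filter_nonempty_iff] at h1
    obtain ⟨a, ha, hoa⟩ := h1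
    exact mem_iUnion₂.2 ⟨a, ha, hoa⟩
  have hbad0 : 0 ≤ bad := measureReal_nonneg
  show bad ≤ μ.real {ω : BondConfig (Fin n) | (A.filter fun x => ω ∈ openConn c x).card ≤ j}
  rcases hu0.eq_or_lt with hu00 | hupos
  · -- `u = 0`: the bad event is null
    have : bad = 0 := le_antisymm (hu00 ▸ hbadX) hbad0
    rw [this]; exact measureReal_nonneg
  · exact (le_of_mul_le_mul_left hub hupos).trans hSI

end Summit.CriticalPhenomena.PercolationContinuityZ3.Theorems

end
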